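import Mathlib.MeasureTheory.Function.Floor
import Literature.Analysis.FluidPDE.HardSphereAlexander
import Literature.Analysis.FluidPDE.HardSphereUniqueness
import HarnessLib

/-!
# The regularised hard-sphere flow on the torus: a one-parameter group on the whole phase space

`Literature.Analysis.FluidPDE.HardSphereAlexander` proves Alexander's theorem on `T^d`
(`HardSphereFlow.nonempty_torus_holds`): for `0 < ε < 1/2` the collision-by-collision flow
`Alexander.flow (Torus.geometry d) ε` is, on its invariant Liouville-conull good set
`Alexander.good`, a measurable one-parameter group of hard-sphere trajectories preserving the
Liouville measure. Off the good set its values are junk (whatever the explicit formulas give),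
and there the group law `T^{s+t} = T^s ∘ T^t` may fail.

The iterated Duhamel formula of the BBGKY hierarchy (Bodineau–Gallagher–Saint-Raymond 2016 §3.1;
`Literature.MathematicalPhysics.KineticTheory.HierarchyDuhamelSeries`) is an identity between
iterated integrals of functions composed with the `s`-particle flows at EVERY configuration, and
its algebra (restarting Duhamel's formula from an intermediate time,
`HierarchyModel.isMildSolution_of_duhamel_zero`) uses the group law of the transports
everywhere. This file provides the flows for that purpose:

* `Alexander.regFlow G ε t z` — the *regularised flow*: `Alexander.flow G ε t z` for `z` in the
  good set, and `z` itself otherwise (the junk values are replaced by the identity);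
* on the torus, `0 < ε < 1/2`: `regFlow_add` (**the group law at every point**), `regFlow_zero`
  (`Φ_0 = id` everywhere), `configEnergy_regFlow` (conservation of energy everywhere),
  `measurable_regFlow`, and `measurable_regFlow_uncurry` (**joint measurability in `(t, z)`**,
  from the right-continuity of good orbits through the general lemma
  `measurable_uncurry_of_rightContinuous`);
* `Alexander.regHardSphereFlow hε hε' N : HardSphereFlow (Torus.geometry d) ε N` — the regularised
  flow IS a hard-sphere flow with good set `Alexander.good` (it agrees with `Alexander.flow`
  there), in particular it preserves the Liouville measure; `HardSphereFlow.flow_ae_eq_regFlow`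
  (dot-notation extension of the K2 structure, declared with its absolute name): by
  `HardSphereFlow.flow_eq_ae_holds` every hard-sphere flow agrees with it Liouville-a.e. at every
  time;
* the general lemma `Literature.Analysis.FluidPDE.measurable_uncurry_of_rightContinuous` (with
  `tendsto_ceil_two_pow_div`), declared in this file's path namespace.

## References

* C. Cercignani, R. Illner, M. Pulvirenti, *The Mathematical Theory of Dilute Gases* (1994),
  §4.2: Thm. 4.2.1 (the pathological data are Lebesgue-null) and the paragraph following it,
  p. 65 ("The family `{T^t}` is a group: `T⁰ = id`, `T^t ∘ T^s = T^{t+s}`" on `Γ₀`).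
* I. Gallagher, L. Saint-Raymond, B. Texier, *From Newton to Boltzmann* (2013), Prop. 4.1.1.
* T. Bodineau, I. Gallagher, L. Saint-Raymond, Invent. Math. 203 (2016), §3.1 and Remark 3.1
  (the transports `S_s` of the iterated Duhamel formula).
-/

open Set Filter Topology Function MeasureTheory Metric
open scoped ENNReal

namespace Literature.Analysis.FluidPDE

/-! ## Joint measurability of right-continuous, measurable-in-space maps -/

section RightContinuous

variable {α β : Type*} [MeasurableSpace α] [TopologicalSpace β] [TopologicalSpace.PseudoMetrizableSpace β]
  [MeasurableSpace β] [BorelSpace β]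

/-- The dyadic approximation from the right converges from the right: `⌈t 2ⁿ⌉ / 2ⁿ → t` within
`[t, ∞)`. [folklore] -/
theorem tendsto_ceil_two_pow_div (t : ℝ) :
    Tendsto (fun n : ℕ => (⌈t * 2 ^ n⌉ : ℝ) / 2 ^ n) atTop (𝓝[≥] t) := by
  have h2 : ∀ n : ℕ, (0 : ℝ) < 2 ^ n := fun n => by positivity
  refine tendsto_nhdsWithin_iff.2 ⟨?_, Eventually.of_forall fun n => ?_⟩
  · -- `t ≤ ⌈t 2ⁿ⌉/2ⁿ < t + 2⁻ⁿ`
    have hlow : ∀ n : ℕ, t ≤ (⌈t * 2 ^ n⌉ : ℝ) / 2 ^ n := fun n => by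
      rw [le_div_iff₀ (h2 n)]
      exact Int.le_ceil _
    have hup : ∀ n : ℕ, (⌈t * 2 ^ n⌉ : ℝ) / 2 ^ n ≤ t + (1 / 2) ^ n := fun n => by
      rw [div_le_iff₀ (h2 n), add_mul, one_div, inv_pow, inv_mul_cancel₀ (h2 n).ne']
      exact (Int.ceil_lt_add_one _).le
    have hlim : Tendsto (fun n : ℕ => t + (1 / 2 : ℝ) ^ n) atTop (𝓝 t) := by
      have := tendsto_pow_atTop_nhds_zero_of_lt_one (r := (1 / 2 : ℝ)) (by norm_num) (by norm_num)
      simpa using this.const_add t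
    exact tendsto_of_tendsto_of_tendsto_of_le_of_le tendsto_const_nhds hlim hlow hup
  · show t ≤ (⌈t * 2 ^ n⌉ : ℝ) / 2 ^ n
    rw [le_div_iff₀ (h2 n)]
    exact Int.le_ceil _

/-- **A map `u : ℝ → α → β` which is right-continuous in time at every point and measurable in
space at every time is jointly measurable** (`β` pseudo-metrisable Borel): the dyadic
approximations from the right `(t, x) ↦ u (⌈t 2ⁿ⌉/2ⁿ) x` are measurable (countably many
measurable time slices) and converge pointwise (`measurable_of_tendsto_metrizable`). The
right-continuous analogue of Mathlib's `measurable_uncurry_of_continuous_of_measurable`. [folklore] -/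
theorem measurable_uncurry_of_rightContinuous {u : ℝ → α → β}
    (hu_cont : ∀ x t, ContinuousWithinAt (fun s => u s x) (Ici t) t)
    (h : ∀ t, Measurable (u t)) : Measurable (Function.uncurry u) := by
  let U : ℕ → ℝ × α → β := fun n p => u ((⌈p.1 * 2 ^ n⌉ : ℝ) / 2 ^ n) p.2
  have hU : ∀ n, Measurable (U n) := by
    intro n
    have hg : Measurable fun q : ℤ × α => u ((q.1 : ℝ) / 2 ^ n) q.2 :=
      measurable_from_prod_countable_right fun k =>
        show Measurable fun y => u ((k : ℝ) / 2 ^ n) y from h _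
    have hc : Measurable fun p : ℝ × α => ((⌈p.1 * 2 ^ n⌉ : ℤ), p.2) :=
      (Int.measurable_ceil.comp (measurable_fst.mul_const _)).prodMk measurable_snd
    exact hg.comp hc
  refine measurable_of_tendsto_metrizable hU (tendsto_pi_nhds.2 fun p => ?_)
  exact ((hu_cont p.2 p.1).tendsto).comp (tendsto_ceil_two_pow_div p.1)

end RightContinuous

noncomputable section

section Kinetic

namespace Alexander

variable {d : Type*} [Fintype d] {X : Type*} {N : ℕ}

/-! ## The regularised flow -/

section Def

variable (G : Geometry d X) (ε : ℝ)

open Classical in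
/-- The **regularised hard-sphere flow**: the collision-by-collision flow `Alexander.flow` on its
good set `Alexander.good`, and the identity off it. On the torus (`0 < ε < 1/2`) this is a
one-parameter group on the WHOLE phase space (`regFlow_add`, `regFlow_zero`), measurable jointly
in `(t, z)`, conserving the kinetic energy, and a hard-sphere flow with the same good set
(`regHardSphereFlow`). [cite: CIP1994, §4.2 p. 65] -/
def regFlow (t : ℝ) (z : Config N d X) : Config N d X :=
  if z ∈ good G ε then flow G ε t z else z

variable {G ε}

/-- On the good set the regularised flow is the collision-by-collision flow. [folklore] -/
theorem regFlow_of_mem {z : Config N d X} (hz : z ∈ good G ε) (t : ℝ) :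
    regFlow G ε t z = flow G ε t z := by
  simp [regFlow, hz]

/-- Off the good set the regularised flow is the identity. [folklore] -/
theorem regFlow_of_not_mem {z : Config N d X} (hz : z ∉ good G ε) (t : ℝ) :
    regFlow G ε t z = z := by
  simp [regFlow, hz]

/-- **Conservation of energy** for the regularised flow, at every datum. [folklore] -/
@[simp]
theorem configEnergy_regFlow (t : ℝ) (z : Config N d X) :
    configEnergy (regFlow G ε t z) = configEnergy z := by
  by_cases hz : z ∈ good G ε
  · rw [regFlow_of_mem hz, configEnergy_flow]
  · rw [regFlow_of_not_mem hz]

/-- The orbit of a good point under the regularised flow is its orbit under the flow. [folklore] -/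
theorem regFlow_orbit_of_mem {z : Config N d X} (hz : z ∈ good G ε) :
    (fun t => regFlow G ε t z) = fun t => flow G ε t z :=
  funext fun t => regFlow_of_mem hz t

end Def

/-! ## The torus: group law everywhere, measurability, the hard-sphere flow -/

section Torus

variable {ε : ℝ}

/-- The phase space of one particle on the torus is a Borel space (registered as a lemma to feed
`Pi.borelSpace`, whose instance search does not find it under the binder). [folklore] -/
theorem borelSpace_phaseSpace_torus : BorelSpace (UnitAddTorus d × EuclideanSpace ℝ d) :=
  inferInstance

/-- The `N`-particle phase space on the torus is a Borel space. [folklore] -/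
instance _root_.Literature.Analysis.FluidPDE.Config.borelSpace_torus :
    BorelSpace (Config N d (UnitAddTorus d)) :=
  @Pi.borelSpace (Fin N) (fun _ => UnitAddTorus d × EuclideanSpace ℝ d) _ _ _ _
    fun _ => borelSpace_phaseSpace_torus

/-- **`Φ_0 = id` at every point** for the regularised flow on `T^d`, `0 < ε < 1/2`
(`torusFlow_group_holds` on the good set, the identity off it). [cite: CIP1994, §4.2 p. 65] -/
theorem regFlow_zero (hε : 0 < ε) (hε' : ε < 2⁻¹) (z : Config N d (UnitAddTorus d)) :
    regFlow (Torus.geometry d) ε 0 z = z := by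
  by_cases hz : z ∈ good (Torus.geometry d) ε
  · rw [regFlow_of_mem hz]
    exact (torusFlow_group_holds (d := d) hε hε' N).2.1 z hz
  · exact regFlow_of_not_mem hz 0

/-- The regularised flow maps the good set to itself. [folklore] -/
theorem mapsTo_regFlow_good (hε : 0 < ε) (hε' : ε < 2⁻¹) (t : ℝ) :
    MapsTo (regFlow (N := N) (Torus.geometry d) ε t) (good (Torus.geometry d) ε)
      (good (Torus.geometry d) ε) := by
  intro z hz
  rw [regFlow_of_mem hz]
  exact (torusFlow_group_holds (d := d) hε hε' N).1 t hz

/-- **The group law at every point** for the regularised flow on `T^d`, `0 < ε < 1/2`: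
`Φ_{s+t} z = Φ_s (Φ_t z)` for ALL `z` (`torusFlow_group_holds` and invariance of the good set on
it; both sides are `z` off it). This is the hypothesis `hflow` of
`HierarchyModel.isMildSolution_of_duhamel_zero` / `isMildSolution_seriesFamily`. [cite: CIP1994, §4.2 p. 65] -/
theorem regFlow_add (hε : 0 < ε) (hε' : ε < 2⁻¹) (s t : ℝ) (z : Config N d (UnitAddTorus d)) :
    regFlow (Torus.geometry d) ε (s + t) z =
      regFlow (Torus.geometry d) ε s (regFlow (Torus.geometry d) ε t z) := by
  by_cases hz : z ∈ good (Torus.geometry d) ε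
  · rw [regFlow_of_mem hz, regFlow_of_mem hz,
      regFlow_of_mem ((torusFlow_group_holds (d := d) hε hε' N).1 t hz)]
    exact (torusFlow_group_holds (d := d) hε hε' N).2.2 s t z hz
  · rw [regFlow_of_not_mem hz, regFlow_of_not_mem hz, regFlow_of_not_mem hz]

/-- Each time map of the regularised flow on `T^d` is measurable (`0 < ε < 1/2`). [folklore] -/
theorem measurable_regFlow (hε' : ε < 2⁻¹) (t : ℝ) :
    Measurable (regFlow (N := N) (Torus.geometry d) ε t) := by
  classical
  have hG := Torus.isHardSphereRegular_geometry (d := d) hε'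
  have hGm : (Torus.geometry d).IsMeasurable := Torus.isMeasurable_geometry
  unfold regFlow
  exact Measurable.ite (measurableSet_good hG hGm) (measurable_flow hG hGm t) measurable_id

/-- Good orbits of the flow on `T^d` are right-continuous (`0 < ε < 1/2`): they are
hard-sphere trajectories in the right-continuous convention (`tendsto_flow_nhdsGT_of_nonneg`,
`tendsto_flow_nhdsGT_of_neg`). [folklore] -/
theorem continuousWithinAt_Ici_flow (hε' : ε < 2⁻¹) {z : Config N d (UnitAddTorus d)}
    (hz : z ∈ good (Torus.geometry d) ε) (t : ℝ) :
    ContinuousWithinAt (fun s => flow (Torus.geometry d) ε s z) (Ici t) t := by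
  have hG := Torus.isHardSphereRegular_geometry (d := d) hε'
  rw [← continuousWithinAt_Ioi_iff_Ici]
  rcases le_or_gt 0 t with ht | ht
  · exact tendsto_flow_nhdsGT_of_nonneg hG hz ht
  · exact tendsto_flow_nhdsGT_of_neg hG hz ht

/-- **Joint measurability** of the regularised flow on `T^d` in `(t, z)` (`0 < ε < 1/2`): each
orbit is right-continuous (a good orbit, or a constant) and each time map is measurable
(`measurable_uncurry_of_rightContinuous`). This is the hypothesis `measurable_flow` of
`Kinetic.HierarchyModel` for the hard-sphere transports. [folklore] -/
theorem measurable_regFlow_uncurry (hε' : ε < 2⁻¹) :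
    Measurable fun p : ℝ × Config N d (UnitAddTorus d) => regFlow (Torus.geometry d) ε p.1 p.2 := by
  refine measurable_uncurry_of_rightContinuous (u := fun t z => regFlow (Torus.geometry d) ε t z)
    (fun z t => ?_) (measurable_regFlow hε')
  by_cases hz : z ∈ good (Torus.geometry d) ε
  · simp only [regFlow_of_mem hz]
    exact continuousWithinAt_Ici_flow hε' hz t
  · simp only [regFlow_of_not_mem hz]
    exact continuousWithinAt_const

/-- The regularised flow agrees with the flow Liouville-almost everywhere (they agree on the
good set, whose complement is Liouville-null, `torusFlow_ae_good_holds`). [folklore] -/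
theorem regFlow_ae_eq_flow (hε : 0 < ε) (hε' : ε < 2⁻¹) (t : ℝ) :
    regFlow (Torus.geometry d) ε t =ᵐ[liouville (Torus.geometry d) N ε] flow (Torus.geometry d) ε t := by
  have h : ∀ᵐ z ∂liouville (Torus.geometry d) N ε, z ∈ good (Torus.geometry d) ε :=
    measure_eq_zero_iff_ae_notMem.1 (torusFlow_ae_good_holds (d := d) hε hε' N) |>.mono
      fun z hz => not_not.1 hz
  filter_upwards [h] with z hz
  exact regFlow_of_mem hz t

/-- The regularised flow preserves the Liouville measure (it is a.e. equal to the flow, which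
does, `torusFlow_measurePreserving_holds`). [folklore] -/
theorem measurePreserving_regFlow (hε : 0 < ε) (hε' : ε < 2⁻¹) (t : ℝ) :
    MeasurePreserving (regFlow (Torus.geometry d) ε t) (liouville (Torus.geometry d) N ε)
      (liouville (Torus.geometry d) N ε) := by
  refine ⟨measurable_regFlow hε' t, ?_⟩
  rw [Measure.map_congr (regFlow_ae_eq_flow hε hε' t)]
  exact (torusFlow_measurePreserving_holds (d := d) hε hε' N t).map_eq

/-- **The regularised flow is a hard-sphere flow** on `T^d`, `0 < ε < 1/2`, with good set
`Alexander.good`: the structure `HardSphereFlow` of K2 built on `regFlow` (group law and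
trajectories on the good set from the five discharged facts about the construction, measure
preservation by a.e. agreement with `Alexander.flow`). Unlike a general `HardSphereFlow`, its
flow map is a group on the whole phase space (`regFlow_add`, `regFlow_zero`), jointly measurable
(`measurable_regFlow_uncurry`) and energy-conserving everywhere (`configEnergy_regFlow`).
[cite: CIP1994, §4.2 p. 65 (group on `Γ₀`) and Thm. 4.2.1 (null pathological set)] [cite: GST2013, Prop. 4.1.1 p. 19] -/
def regHardSphereFlow (hε : 0 < ε) (hε' : ε < 2⁻¹) (N : ℕ) :
    HardSphereFlow (Torus.geometry d) ε N where
  flow := regFlow (Torus.geometry d) ε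
  good := good (Torus.geometry d) ε
  measurableSet_good := (torusFlow_measurable_holds (d := d) hε hε' N).1
  good_subset := good_subset_hardSphereDomain
  measure_compl_good := torusFlow_ae_good_holds (d := d) hε hε' N
  mapsTo_good := mapsTo_regFlow_good hε hε'
  flow_zero := fun z _ => regFlow_zero hε hε' z
  flow_add := fun s t z _ => regFlow_add hε hε' s t z
  measurable_flow := measurable_regFlow hε'
  isTrajectory := fun z hz => by
    rw [regFlow_orbit_of_mem hz]
    exact torusFlow_isTrajectory_holds (d := d) hε hε' N z hz
  measurePreserving := measurePreserving_regFlow hε hε'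

/-- The flow map of `regHardSphereFlow` is `regFlow`. [folklore] -/
@[simp]
theorem regHardSphereFlow_flow (hε : 0 < ε) (hε' : ε < 2⁻¹) (N : ℕ) :
    (regHardSphereFlow (d := d) hε hε' N).flow = regFlow (Torus.geometry d) ε := rfl

/-- The good set of `regHardSphereFlow` is `Alexander.good`. [folklore] -/
@[simp]
theorem regHardSphereFlow_good (hε : 0 < ε) (hε' : ε < 2⁻¹) (N : ℕ) :
    (regHardSphereFlow (d := d) hε hε' N).good = good (Torus.geometry d) ε := rfl

/-- **Every hard-sphere flow on `T^d` is the regularised flow almost everywhere**, at every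
time (`HardSphereFlow.flow_eq_ae_holds`, GST 2013 Prop. 4.1.1): statements about the law at
time `t` of a hard-sphere system (e.g. marginals of a transported density) may therefore be
proved for `regHardSphereFlow` only. [cite: GST2013, Prop. 4.1.1 p. 19] -/
theorem _root_.Literature.Analysis.FluidPDE.HardSphereFlow.flow_ae_eq_regFlow (hε : 0 < ε) (hε' : ε < 2⁻¹)
    (Φ : HardSphereFlow (Torus.geometry d) ε N) (t : ℝ) :
    Φ.flow t =ᵐ[liouville (Torus.geometry d) N ε] regFlow (Torus.geometry d) ε t :=
  HardSphereFlow.flow_eq_ae_holds Φ (regHardSphereFlow hε hε' N) t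

end Torus

end Alexander

end Kinetic

end

end Literature.Analysis.FluidPDE
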